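import Summits.BirchSwinnertonDyer.BirchSwinnertonDyer.Theses.TwoAdicConverse
import Literature.NumberTheory.EllipticCurves.BSDSelmerParityDokchitserProofs
import HarnessLib

/-!
# Route `TwoAdicConverse` (rung S3), crux `GoodOrdinaryRankZeroTwoConverse`: the EVEN-RANK FORM —
# modulo Monsky's `2`-parity the crux says exactly «no non-CM curve good ordinary at `2` of EVEN
# analytic rank `≥ 2` has `corank_{ℤ_2} Sel_{2^∞} < 2`»

Cell `bsd-2adic` (run/shared/lean/pub/bsd-2adic/), seat `bsd-2adic-conv-1`. THEOREMS ONLY — nothing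
asserted, no definition, no named fact introduced. A kernel restatement of the crux (item
stmt-BirchSwinnertonDyer-19218) for the planner / tribunal (where its content sits, and what a
refutation must look like — the route's KILL CRITERIA in exact form):

* `goodOrdinaryRankZeroTwoConverse_iff_pos_selmerCorank_of_pos_analyticRank` — tautological
  contrapositive: the crux ⟺ every non-CM globally minimal `W` good ordinary at `2` with
  `ord_{s=1} L(W, s) ≥ 1` has `corank_{ℤ_2} Sel_{2^∞}(W/ℚ) ≥ 1`.
* `goodOrdinaryRankZeroTwoConverse_iff_two_le_selmerCorank_of_even_analyticRank` — modulo MONSKY's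
  congruence `corank_{ℤ_2} Sel_{2^∞}(E) ≡ ord_{s=1} L(E, s) (mod 2)` (`monsky_selmerCorank_two_mod_two_eq`,
  Dokchitser–Dokchitser 2010 Thm. 1.4 at `p = 2` = Monsky 1996; a named fact, hypothesis `hMon`):
  the crux ⟺ every non-CM globally minimal `W` good ordinary at `2` of EVEN analytic rank `≥ 2` has
  `corank_{ℤ_2} Sel_{2^∞}(W/ℚ) ≥ 2`. The odd-rank case is FREE (corank odd, hence `≥ 1`); the crux is
  the `2`-adic shadow, on the even-rank locus, of the rank inequality `corank Sel_{p^∞} ≥ r_an` of BSD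
  in analytic rank `≥ 2` — nothing is claimed about it here.
* `analyticRank_eq_zero_of_selmerCorank_two_eq_zero_of_analyticRank_le_one` — on the locus
  `r_an ≤ 1` the converse is a THEOREM modulo Gross–Zagier–Kolyvagin (`r_an = 1 ⇒ rank = 1 ⇒
  corank ≥ 1`), so every census curve of the cell (all of analytic rank `≤ 1`) satisfies the crux
  for free: its content lives entirely in analytic rank `≥ 2`.

HONEST FRAMING: reformulations only; the crux stays open; BSD is not proved by any of this.
PARTITION (D-0054): none — RANK axis (S3); companion formula cell X5@2 good-ord (B1·O1), owner
bsd-2adic. References: [DokchitserDokchitserAnnals2010] Thm. 1.4, §4.6 (p = 2: Monsky 1996);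
[Monsky1996]; [GreenbergLNM1716] §1 (corank identity); [arXiv250317619] §1 display (1.1).
-/

set_option linter.dupNamespace false
set_option autoImplicit false

noncomputable section

open scoped Classical

open WeierstrassCurve Literature.NumberTheory.EllipticCurves
  Literature.NumberTheory.EllipticCurves.Rank1Residual
  Summit.BirchSwinnertonDyer.BirchSwinnertonDyer.Theses.TwoAdicConverse

namespace Summit.BirchSwinnertonDyer.BirchSwinnertonDyer.Theorems.TwoAdicGoodTwists

/-- **Contrapositive form of the crux** (tautology): `GoodOrdinaryRankZeroTwoConverse` ⟺ every
non-CM globally minimal `W` good ordinary at `2` with `ord_{s=1} L(W, s) ≥ 1` has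
`corank_{ℤ_2} Sel_{2^∞}(W/ℚ) ≥ 1`. [folklore] -/
theorem goodOrdinaryRankZeroTwoConverse_iff_pos_selmerCorank_of_pos_analyticRank :
    GoodOrdinaryRankZeroTwoConverse ↔
      ∀ (W : WeierstrassCurve ℚ) [W.IsElliptic] [W.IsGloballyMinimal], ¬ W.HasCM → GoodOrd W 2 →
        1 ≤ W.analyticRank → 1 ≤ W.selmerCorank 2 := by
  constructor
  · intro h W _ _ hcm hgo hr
    by_contra hs
    have h0 : W.selmerCorank 2 = 0 := by omega
    have := h W hcm hgo h0
    omega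
  · intro h W _ _ hcm hgo hs
    by_contra hr
    have := h W hcm hgo (by omega)
    omega

/-- **Even-rank form of the crux, modulo Monsky's `2`-parity.** Assuming
`corank_{ℤ_2} Sel_{2^∞}(E) ≡ ord_{s=1} L(E, s) (mod 2)` for every elliptic `E/ℚ` (`hMon`):
`GoodOrdinaryRankZeroTwoConverse` ⟺ every non-CM globally minimal `W` good ordinary at `2` with EVEN
analytic rank `≥ 2` has `corank_{ℤ_2} Sel_{2^∞}(W/ℚ) ≥ 2`. (⇒) corank `≠ 0` by the crux and even by
Monsky; (⇐) corank `0` makes `r_an` even, and `r_an ≥ 2` would force corank `≥ 2`.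
[cite: DokchitserDokchitserAnnals2010, Thm. 1.4 and §4.6 (case p = 2)] -/
theorem goodOrdinaryRankZeroTwoConverse_iff_two_le_selmerCorank_of_even_analyticRank
    (hMon : monsky_selmerCorank_two_mod_two_eq) :
    GoodOrdinaryRankZeroTwoConverse ↔
      ∀ (W : WeierstrassCurve ℚ) [W.IsElliptic] [W.IsGloballyMinimal], ¬ W.HasCM → GoodOrd W 2 →
        Even W.analyticRank → 2 ≤ W.analyticRank → 2 ≤ W.selmerCorank 2 := by
  constructor
  · intro h W _ _ hcm hgo hev hr
    have hpar : W.selmerCorank 2 % 2 = W.analyticRank % 2 := hMon W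
    have hev' : W.analyticRank % 2 = 0 := Nat.even_iff.mp hev
    by_contra hs
    have hs01 : W.selmerCorank 2 = 0 ∨ W.selmerCorank 2 = 1 := by omega
    rcases hs01 with h0 | h1
    · have := h W hcm hgo h0
      omega
    · omega
  · intro h W _ _ hcm hgo hs
    have hpar : W.selmerCorank 2 % 2 = W.analyticRank % 2 := hMon W
    rw [hs] at hpar
    by_contra hr
    rcases Nat.lt_or_ge W.analyticRank 2 with hlt | hge
    · omega
    · have hev : Even W.analyticRank := Nat.even_iff.mpr (by omega)
      have := h W hcm hgo hev hge
      omega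

/-- **On the locus `r_an ≤ 1` the rank-`0` `2`-converse is a theorem modulo Gross–Zagier–Kolyvagin.**
For any elliptic `W / ℚ` with `ord_{s=1} L(W, s) ≤ 1` (no CM / reduction hypothesis): if
`corank_{ℤ_2} Sel_{2^∞}(W/ℚ) = 0` then `ord_{s=1} L(W, s) = 0` — since `r_an = 1` gives `rank = 1`
(`hGZK`) and `rank ≤ corank` (the corank identity, Greenberg LNM 1716 §1). So the crux has content
only in analytic rank `≥ 2` (even, by the previous theorem).
[cite: GreenbergLNM1716, §1 pp. 54–57] [cite: arXiv250317619, §1 display (1.1)] -/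
theorem analyticRank_eq_zero_of_selmerCorank_two_eq_zero_of_analyticRank_le_one
    (hGZK : rank_eq_analyticRank_of_analyticRank_le_one)
    (W : WeierstrassCurve ℚ) [W.IsElliptic] (hle : W.analyticRank ≤ 1)
    (hs : W.selmerCorank 2 = 0) : W.analyticRank = 0 := by
  obtain ⟨hrank, -⟩ := hGZK W hle
  have hle' : W.mordellWeilRank ≤ W.selmerCorank 2 := by
    rw [W.selmerCorank_eq_mordellWeilRank_add_holds 2]
    exact Nat.le_add_right _ _
  omega

end Summit.BirchSwinnertonDyer.BirchSwinnertonDyer.Theorems.TwoAdicGoodTwists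

end
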